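import Summits.HodgeConjecture.HodgeConjecture.Theorems.SecondaryPeriodsConiveauOneFailureLevelOneReductionInClass
import Summits.HodgeConjecture.HodgeConjecture.Theorems.SecondaryPeriodsConiveauOneFailureInstrumentForm
import Literature.AlgebraicGeometry.HodgeTheory.AbelianLowDimensionHodgeConjecture
import Literature.AlgebraicGeometry.Motives.AbelianVarietyProjectiveChart
import Literature.AlgebraicGeometry.HodgeTheory.IsoTransport
import Literature.Barriers.HodgeConjecture.GeneralizedHodgeTrivialReasonsEllipticCurveCubedModel

/-!
# Route `SecondaryPeriods`, crux `ConiveauOneFailure` (stmt-HodgeConjecture-3540): NO ABELIAN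
# THREEFOLD IS A WITNESS OF THE HEART (granted Markman 2025)

The heart of the registered line of the crux (`stub_attractorPlane_offCurveCorrespondences`,
`Cruxes/ConiveauOneFailure/Lines/birth.lean`; crux-equivalent modulo its habitat clauses by
`coniveauOneFailure_iff_exists_offCurveCorrespondences`) asks for a smooth projective threefold `Y`
with `h^{3,0}(Y) = 1`, a rational rank-two level-one sub-Hodge plane `V ⊂ H³(Y(ℂ))` and NO finite
family of algebraic curve correspondences carrying `V` (equivalently `V ⊄ N¹H³(Y)`). Its habitat
("Calabi–Yau type", `h^{3,0} = 1`) contains every complex ABELIAN THREEFOLD (`h^{3,0}(A) = 1`) and in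
particular Grothendieck's calibration threefold `E_τ³` of the route (where lead c2 exhibited the
habitat clauses, `exists_levelOnePlane_calabiYauType_ellipticCurveCubed`). This file removes that
sector from the witness space, CONDITIONALLY on one named Literature claim:

`Markman2025_hodgeClasses_algebraic_abelian_dim_le_five` (E. Markman, arXiv:2509.23403 Cor. 1.3 with
arXiv:2502.03415: the Hodge conjecture for complex abelian varieties of dimension `≤ 5`; tagged in the
tree as an unrefereed claim).

The argument is Grothendieck's observation run on an abelian FOURFOLD: a rank-two plane `V` on the
abelian threefold `A` is `φ(H¹(E(ℂ)))` for a one-dimensional abelian variety `E` and a rational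
type-`(1,1)` map `φ` (rank-two Riemann with the group law remembered,
`exists_abelianCurve_of_levelOne_threefold_span_of_finrank_eq_two`); Voisin's Lemma 11.41 makes `φ` a
non-zero rational multiple of the action of a rational `(2,2)`-class `γ` on `A × E`
(`curveCorrespondenceAlgebraic_of_hodgeConjectureFor`); `A × E` is an abelian variety of dimension
`4 ≤ 5` (`AbelianVariety.prod`, `dim_prod`), so `γ` is algebraic by Markman; and the action of an
algebraic codimension-2 class on `A ⊗ E` lands in `N¹H³(A)`
(`range_le_supportedClasses_of_isAlgebraicCorrespondence_curve`, the transfer of this crux).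

* `span_le_supportedClasses_of_finrank_eq_two_of_iso_abelianThreefold` — **rank-two GHC(3,1) for
  every smooth projective threefold ISOMORPHIC to a complex abelian threefold, granted Markman 2025**:
  every rationally spanned level-one sub-Hodge structure of `H³(Y(ℂ); ℂ)` of dimension `2` lies in
  `N¹H³(Y)` (the Hodge conjecture in codimension `2` transports along `Y ⊗ E ≅ A ⊗ E`,
  `forall_hodgeClass_mem_algebraicClasses_iff_of_iso`); `span_le_supportedClasses_of_finrank_eq_two_abelianThreefold`
  — the case `Y = A.X`;
* `carried_of_finrank_eq_two_abelianThreefold` — the same in the heart's vocabulary: the plane IS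
  carried by finitely many algebraic curve correspondences;
* `not_iso_abelianThreefold_of_heartWitness` — **a witness `(Y, A, s)` of the heart is not isomorphic
  to (the underlying variety of) an abelian threefold**; `not_abelianThreefold_of_heartWitness` — nor
  equal to one;
* `span_le_supportedClasses_of_finrank_eq_two_ellipticCurveCubed` — in particular at Grothendieck's
  calibration threefold `E_τ³ = cubeScheme τ hτ` (which IS `(E_τ × (E_τ × E_τ)).X` for the bundled
  elliptic curve `E_τ`, by `rfl`) no rank-two plane is a witness: the route's calibration kill
  criterion (c) passes formally in rank two, granted Markman.

So, granted Markman 2025, the negative bet of the route must be placed OUTSIDE the abelian sector of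
its habitat — at threefolds such as the K3-fibred Calabi–Yau attractor pencils the route names
(CandelasEtAl2020 §6, BonischEtAl2024 §3.3), for which no case of the Hodge conjecture on `Y × E` is
known. Everything is proved (axioms `propext`, `Classical.choice`, `Quot.sound`); the Markman claim
enters as an explicit hypothesis of each theorem (conditional results); no definition, no named fact.

## References

* [Markman2025SurveySecant] E. Markman, Secant sheaves and Weil classes on abelian varieties,
  arXiv:2509.23403 (2025), Cor. 1.3.  * [Markman2025SecantWeil] E. Markman, arXiv:2502.03415 (2025).
* [GrothendieckTopology1969] A. Grothendieck, Hodge's general conjecture is false for trivial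
  reasons, Topology 8 (1969), pp. 300–301.
* [KerrPearlstein2016] M. Kerr, G. Pearlstein (eds.), Recent Advances in Hodge Theory, Ch. 11
  (S. Abdulali), §1 p. 288 and Prop. 3.2 p. 291.
* [VoisinHodgeI2002] C. Voisin, Hodge Theory and Complex Algebraic Geometry I, §11.3.3 Lemma 11.41.
* [CandelasEtAl2020] P. Candelas, X. de la Ossa, M. Elmi, D. van Straten, §6.
* [BonischEtAl2024] K. Bönisch, A. Klemm, E. Scheidegger, D. Zagier, §3.3.
-/

noncomputable section

-- every declaration of this problem lives in `Summit.HodgeConjecture.HodgeConjecture.…` (summit = sub-problem), which `linter.dupNamespace` flags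
set_option linter.dupNamespace false

namespace Summit.HodgeConjecture.HodgeConjecture.Theorems

open CategoryTheory MonoidalCategory
open Literature.AlgebraicGeometry.Motives Literature.AlgebraicGeometry.HodgeTheory
  Literature.AlgebraicTopology.SingularHomology
open Literature.Barriers.HodgeConjecture (cubeScheme cubePeriodPair)

/-! ### Rank-two GHC(3,1) for abelian threefolds, granted Markman 2025 -/

/-- **Rank-two GHC(3,1) for threefolds isomorphic to complex abelian threefolds, granted the Hodge
conjecture for abelian varieties of dimension `≤ 5` (Markman 2025).** For a smooth projective
threefold `Y` with an isomorphism `e : Y ≅ A.X` onto a complex abelian variety `A` of dimension `3`, a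
Hodge model `M` of `Y` and a finite set `s` of rational classes of `H³(Y(ℂ); ℂ)` whose span `V` is
sub-Hodge, of Hodge coniveau `≥ 1` and of dimension `2`: `V ⊆ N¹H³(Y)`. Proof: `V = φ(H¹(E(ℂ)))` for
a one-dimensional abelian variety `E` and a rational type-`(1,1)` map `φ`
(`exists_abelianCurve_of_levelOne_threefold_span_of_finrank_eq_two`); the Hodge conjecture in
codimension `2` on the abelian fourfold `A × E` (`Markman2025_hodgeClasses_algebraic_abelian_dim_le_five`
at `A.prod E`, `dim = 3 + 1`, smooth projective by `AbelianVariety.isSmoothProjective_holds` and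
`IsSmoothProjective.tensor_holds`) transports to `Y ⊗ E` along `e ▷ E`
(`forall_hodgeClass_mem_algebraicClasses_iff_of_iso`) and makes `φ = [γ]_*` for an ALGEBRAIC
`γ ∈ N²H⁴((Y ⊗ E)(ℂ))` (`curveCorrespondenceAlgebraic_of_hodgeConjectureFor`, Voisin I Lemma 11.41),
whose image lies in `N¹H³(Y)` (`range_le_supportedClasses_of_isAlgebraicCorrespondence_curve`).
Grothendieck's observation "HC for `Y × E` ⟹ `V ⊂ N¹H³(Y)`" in the one case where HC for `Y × E` is
in print. [claim: Markman2025SurveySecant, status: under-review] [cite: GrothendieckTopology1969, p. 301]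
[cite: KerrPearlstein2016, Ch. 11 (Abdulali) Prop. 3.2 p. 291] [cite: VoisinHodgeI2002, §11.3.3 Lemma 11.41] -/
theorem span_le_supportedClasses_of_finrank_eq_two_of_iso_abelianThreefold
    (hM : Markman2025_hodgeClasses_algebraic_abelian_dim_le_five)
    {Y : SchemeOver ℂ} (hY : IsSmoothProjective 3 Y) (A : AbelianVariety ℂ) (hA : A.dim = 3)
    (e : Y ≅ A.X) (M : HodgeModel 3 Y)
    (s : Finset (complexBetti Y 3)) (hs : ∀ c ∈ s, IsRationalClass c)
    (hs2 : Module.finrank ℂ (Submodule.span ℂ (↑s : Set (complexBetti Y 3))) = 2)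
    (hsub : (Submodule.span ℂ (↑s : Set (complexBetti Y 3))).map (M.pullback 3).hom =
      ⨆ (p : ℕ) (q : ℕ) (_ : p + q = 3),
        (Submodule.span ℂ (↑s : Set (complexBetti Y 3))).map (M.pullback 3).hom ⊓ M.hodgePQ 3 p q)
    (hlev : (Submodule.span ℂ (↑s : Set (complexBetti Y 3))).map (M.pullback 3).hom ≤
      ⨆ (p : ℕ) (q : ℕ) (_ : p + q = 3) (_ : 1 ≤ p) (_ : 1 ≤ q), M.hodgePQ 3 p q) :
    Submodule.span ℂ (↑s : Set (complexBetti Y 3)) ≤ supportedClasses Y 3 1 := by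
  have hAX : IsSmoothProjective 3 A.X := by
    have h : IsSmoothProjective A.dim A.X := AbelianVariety.isSmoothProjective_holds
    rwa [hA] at h
  obtain ⟨E, hE, hC, B, φ, hφ, hφH, hrange⟩ :=
    exists_abelianCurve_of_levelOne_threefold_span_of_finrank_eq_two hY M s hs hs2 hsub hlev
  obtain ⟨μ⟩ : Nonempty OrientationFamily :=
    ⟨fun _ _ h ↦ Classical.choice (ComplexPoints.isOrientableOver ℂ h)⟩
  -- the abelian fourfold `A × E`
  have h4 : (A.prod E).dim = 3 + 1 := by rw [AbelianVariety.dim_prod, hA, hE]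
  have hX4 : IsSmoothProjective (A.prod E).dim (A.prod E).X := by
    rw [h4]; exact IsSmoothProjective.tensor_holds hAX hC
  -- HC in codimension `2` on `A × E` (Markman), transported to `Y ⊗ E` along `e ▷ E`
  have hHC' : ∀ γ : complexBetti (A.X ⊗ E.X) (2 * 2), IsRationalClass γ →
      IsOfHodgeType (3 + 1) (A.X ⊗ E.X) (2 * 2) 2 2 γ → γ ∈ algebraicClasses (A.X ⊗ E.X) 2 :=
    fun γ hγ hγH ↦ hM (A.prod E) (by omega) hX4 2 γ hγ (by rw [h4]; exact hγH)
  have hHC : ∀ γ : complexBetti (Y ⊗ E.X) (2 * 2), IsRationalClass γ →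
      IsOfHodgeType (3 + 1) (Y ⊗ E.X) (2 * 2) 2 2 γ → γ ∈ algebraicClasses (Y ⊗ E.X) 2 :=
    (forall_hodgeClass_mem_algebraicClasses_iff_of_iso (whiskerRightIso e E.X) 2).2 hHC'
  -- `φ = [γ]_*`, `γ` algebraic, and the image of an algebraic curve correspondence lies in `N¹H³`
  obtain ⟨γ, hγ, hγφ⟩ := curveCorrespondenceAlgebraic_of_hodgeConjectureFor hY hC hHC M B φ hφ hφH μ
  rw [← hrange, ← hγφ]
  exact range_le_supportedClasses_of_isAlgebraicCorrespondence_curve hY hC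
    (isAlgebraicCorrespondence_corrAction μ (OrientationFamily.hasPoincareDuality μ) hY hC
      (show 1 + 2 * 2 = 3 + 2 * 1 from rfl) (show 3 + 3 = 2 * 3 from rfl) hγ)

/-- **Rank-two GHC(3,1) for complex abelian threefolds, granted Markman 2025** — the case `Y = A.X`,
`e = 𝟙` of `span_le_supportedClasses_of_finrank_eq_two_of_iso_abelianThreefold`: every rationally
spanned level-one sub-Hodge structure of `H³(A(ℂ); ℂ)` of dimension `2` lies in `N¹H³(A)`.
[claim: Markman2025SurveySecant, status: under-review] [cite: GrothendieckTopology1969, p. 301] -/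
theorem span_le_supportedClasses_of_finrank_eq_two_abelianThreefold
    (hM : Markman2025_hodgeClasses_algebraic_abelian_dim_le_five)
    (A : AbelianVariety ℂ) (hA : A.dim = 3) (M : HodgeModel 3 A.X)
    (s : Finset (complexBetti A.X 3)) (hs : ∀ c ∈ s, IsRationalClass c)
    (hs2 : Module.finrank ℂ (Submodule.span ℂ (↑s : Set (complexBetti A.X 3))) = 2)
    (hsub : (Submodule.span ℂ (↑s : Set (complexBetti A.X 3))).map (M.pullback 3).hom =
      ⨆ (p : ℕ) (q : ℕ) (_ : p + q = 3),
        (Submodule.span ℂ (↑s : Set (complexBetti A.X 3))).map (M.pullback 3).hom ⊓ M.hodgePQ 3 p q)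
    (hlev : (Submodule.span ℂ (↑s : Set (complexBetti A.X 3))).map (M.pullback 3).hom ≤
      ⨆ (p : ℕ) (q : ℕ) (_ : p + q = 3) (_ : 1 ≤ p) (_ : 1 ≤ q), M.hodgePQ 3 p q) :
    Submodule.span ℂ (↑s : Set (complexBetti A.X 3)) ≤ supportedClasses A.X 3 1 := by
  have hY : IsSmoothProjective 3 A.X := by
    have h : IsSmoothProjective A.dim A.X := AbelianVariety.isSmoothProjective_holds
    rwa [hA] at h
  exact span_le_supportedClasses_of_finrank_eq_two_of_iso_abelianThreefold hM hY A hA (Iso.refl _) M s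
    hs hs2 hsub hlev

/-- **The same in the heart's vocabulary: on an abelian threefold every rank-two rational level-one
sub-Hodge plane of `H³` IS carried by finitely many algebraic curve correspondences** (granted
Markman 2025) — by the transfer `le_supportedClasses_iff_exists_curveCorrespondences` of this crux.
[claim: Markman2025SurveySecant, status: under-review] [cite: GrothendieckTopology1969, p. 301] -/
theorem carried_of_finrank_eq_two_abelianThreefold
    (hM : Markman2025_hodgeClasses_algebraic_abelian_dim_le_five)
    (A : AbelianVariety ℂ) (hA : A.dim = 3) (M : HodgeModel 3 A.X)
    (s : Finset (complexBetti A.X 3)) (hs : ∀ c ∈ s, IsRationalClass c)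
    (hs2 : Module.finrank ℂ (Submodule.span ℂ (↑s : Set (complexBetti A.X 3))) = 2)
    (hsub : (Submodule.span ℂ (↑s : Set (complexBetti A.X 3))).map (M.pullback 3).hom =
      ⨆ (p : ℕ) (q : ℕ) (_ : p + q = 3),
        (Submodule.span ℂ (↑s : Set (complexBetti A.X 3))).map (M.pullback 3).hom ⊓ M.hodgePQ 3 p q)
    (hlev : (Submodule.span ℂ (↑s : Set (complexBetti A.X 3))).map (M.pullback 3).hom ≤
      ⨆ (p : ℕ) (q : ℕ) (_ : p + q = 3) (_ : 1 ≤ p) (_ : 1 ≤ q), M.hodgePQ 3 p q) :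
    ∃ (ι : Type) (_ : Finite ι) (C : ι → SchemeOver ℂ) (_ : ∀ j, IsSmoothProjective 1 (C j))
      (T : ∀ j, complexBetti (C j) 1 →ₗ[ℂ] complexBetti A.X 3),
      (∀ j, IsAlgebraicCorrespondence 3 1 A.X (C j) (T j)) ∧
        Submodule.span ℂ (↑s : Set (complexBetti A.X 3)) ≤ ⨆ j, LinearMap.range (T j) := by
  have hY : IsSmoothProjective 3 A.X := by
    have h : IsSmoothProjective A.dim A.X := AbelianVariety.isSmoothProjective_holds
    rwa [hA] at h
  exact (le_supportedClasses_iff_exists_curveCorrespondences hY _).1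
    (span_le_supportedClasses_of_finrank_eq_two_abelianThreefold hM A hA M s hs hs2 hsub hlev)

/-! ### No abelian threefold is a witness of the heart -/

/-- **A witness of the heart of `ConiveauOneFailure` is not isomorphic to an abelian threefold
(granted Markman 2025).** If a smooth projective threefold `Y` carries a finite set `s` of rational
classes of `H³(Y(ℂ); ℂ)` whose span is sub-Hodge (for a Hodge model `M`), of Hodge coniveau `≥ 1`, of
dimension `2` and carried by NO finite family of algebraic curve correspondences — the registered
heart `stub_attractorPlane_offCurveCorrespondences` unfolded, its clause `h^{3,0} = 1` not even
needed — then `Y` is not isomorphic, as a `ℂ`-scheme, to the underlying variety of any complex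
abelian variety of dimension `3`. So the negative bet of the route lives outside the abelian sector
of its habitat (e.g. at the K3-fibred Calabi–Yau attractor pencils, where no case of HC on `Y × E` is
known). [claim: Markman2025SurveySecant, status: under-review] [cite: GrothendieckTopology1969, p. 301]
[cite: CandelasEtAl2020, §6] [cite: BonischEtAl2024, §3.3] -/
theorem not_iso_abelianThreefold_of_heartWitness
    (hM : Markman2025_hodgeClasses_algebraic_abelian_dim_le_five)
    {Y : SchemeOver ℂ} (hY : IsSmoothProjective 3 Y) (M : HodgeModel 3 Y) (s : Finset (complexBetti Y 3))
    (hs : ∀ c ∈ s, IsRationalClass c)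
    (hsub : (Submodule.span ℂ (↑s : Set (complexBetti Y 3))).map (M.pullback 3).hom =
      ⨆ (p : ℕ) (q : ℕ) (_ : p + q = 3),
        (Submodule.span ℂ (↑s : Set (complexBetti Y 3))).map (M.pullback 3).hom ⊓ M.hodgePQ 3 p q)
    (hlev : (Submodule.span ℂ (↑s : Set (complexBetti Y 3))).map (M.pullback 3).hom ≤
      ⨆ (p : ℕ) (q : ℕ) (_ : p + q = 3) (_ : 1 ≤ p) (_ : 1 ≤ q), M.hodgePQ 3 p q)
    (hs2 : Module.finrank ℂ (Submodule.span ℂ (↑s : Set (complexBetti Y 3))) = 2)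
    (hoff : ¬ ∃ (ι : Type) (_ : Finite ι) (C : ι → SchemeOver ℂ) (_ : ∀ j, IsSmoothProjective 1 (C j))
      (T : ∀ j, complexBetti (C j) 1 →ₗ[ℂ] complexBetti Y 3),
      (∀ j, IsAlgebraicCorrespondence 3 1 Y (C j) (T j)) ∧
        Submodule.span ℂ (↑s : Set (complexBetti Y 3)) ≤ ⨆ j, LinearMap.range (T j)) :
    ¬ ∃ A : AbelianVariety ℂ, A.dim = 3 ∧ Nonempty (Y ≅ A.X) := by
  rintro ⟨A, hA, ⟨e⟩⟩
  exact hoff ((le_supportedClasses_iff_exists_curveCorrespondences hY _).1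
    (span_le_supportedClasses_of_finrank_eq_two_of_iso_abelianThreefold hM hY A hA e M s hs hs2 hsub hlev))

/-- **A witness of the heart of `ConiveauOneFailure` is not an abelian threefold (granted Markman
2025).** If a smooth projective threefold `Y` carries a finite set `s` of rational classes of
`H³(Y(ℂ); ℂ)` whose span is sub-Hodge (for a Hodge model `M`), of Hodge coniveau `≥ 1`, of
dimension `2` and carried by NO finite family of algebraic curve correspondences — the registered
heart `stub_attractorPlane_offCurveCorrespondences` unfolded, its clause `h^{3,0} = 1` not even
needed — then `Y` is not the underlying variety of any complex abelian variety of dimension `3`.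
So the negative bet of the route lives outside the abelian sector of its habitat (e.g. at the
K3-fibred Calabi–Yau attractor pencils, where no case of HC on `Y × E` is known).
[claim: Markman2025SurveySecant, status: under-review] [cite: GrothendieckTopology1969, p. 301]
[cite: CandelasEtAl2020, §6] [cite: BonischEtAl2024, §3.3] -/
theorem not_abelianThreefold_of_heartWitness
    (hM : Markman2025_hodgeClasses_algebraic_abelian_dim_le_five)
    {Y : SchemeOver ℂ} (M : HodgeModel 3 Y) (s : Finset (complexBetti Y 3))
    (hs : ∀ c ∈ s, IsRationalClass c)
    (hsub : (Submodule.span ℂ (↑s : Set (complexBetti Y 3))).map (M.pullback 3).hom =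
      ⨆ (p : ℕ) (q : ℕ) (_ : p + q = 3),
        (Submodule.span ℂ (↑s : Set (complexBetti Y 3))).map (M.pullback 3).hom ⊓ M.hodgePQ 3 p q)
    (hlev : (Submodule.span ℂ (↑s : Set (complexBetti Y 3))).map (M.pullback 3).hom ≤
      ⨆ (p : ℕ) (q : ℕ) (_ : p + q = 3) (_ : 1 ≤ p) (_ : 1 ≤ q), M.hodgePQ 3 p q)
    (hs2 : Module.finrank ℂ (Submodule.span ℂ (↑s : Set (complexBetti Y 3))) = 2)
    (hoff : ¬ ∃ (ι : Type) (_ : Finite ι) (C : ι → SchemeOver ℂ) (_ : ∀ j, IsSmoothProjective 1 (C j))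
      (T : ∀ j, complexBetti (C j) 1 →ₗ[ℂ] complexBetti Y 3),
      (∀ j, IsAlgebraicCorrespondence 3 1 Y (C j) (T j)) ∧
        Submodule.span ℂ (↑s : Set (complexBetti Y 3)) ≤ ⨆ j, LinearMap.range (T j)) :
    ¬ ∃ A : AbelianVariety ℂ, A.dim = 3 ∧ A.X = Y := by
  rintro ⟨A, hA, rfl⟩
  exact hoff (carried_of_finrank_eq_two_abelianThreefold hM A hA M s hs hs2 hsub hlev)

/-- **The heart, if true, is witnessed outside the abelian sector** (granted Markman 2025): from the
registered heart (binders verbatim) one gets a witness `(Y, M, s)` — a Calabi–Yau-type threefold with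
a rational rank-two plane off `N¹H³(Y)` — with `Y` NOT isomorphic to the underlying variety of an
abelian threefold. [claim: Markman2025SurveySecant, status: under-review]
[cite: GrothendieckTopology1969, p. 301] [cite: CandelasEtAl2020, §6] -/
theorem heart_witness_not_abelian
    (hM : Markman2025_hodgeClasses_algebraic_abelian_dim_le_five)
    (h : ∃ (Y : SchemeOver ℂ) (_ : IsSmoothProjective 3 Y) (M : HodgeModel 3 Y)
      (s : Finset (complexBetti Y 3)),
      (∀ c ∈ s, IsRationalClass c) ∧
      (Submodule.span ℂ (↑s : Set (complexBetti Y 3))).map (M.pullback 3).hom =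
        (⨆ (p : ℕ) (q : ℕ) (_ : p + q = 3),
          (Submodule.span ℂ (↑s : Set (complexBetti Y 3))).map (M.pullback 3).hom ⊓
            M.hodgePQ 3 p q) ∧
      (Submodule.span ℂ (↑s : Set (complexBetti Y 3))).map (M.pullback 3).hom ≤
        (⨆ (p : ℕ) (q : ℕ) (_ : p + q = 3) (_ : 1 ≤ p) (_ : 1 ≤ q), M.hodgePQ 3 p q) ∧
      Module.finrank ℂ (M.hodgePQ 3 3 0) = 1 ∧
      Module.finrank ℂ (Submodule.span ℂ (↑s : Set (complexBetti Y 3))) = 2 ∧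
      ¬ ∃ (ι : Type) (_ : Finite ι) (C : ι → SchemeOver ℂ) (_ : ∀ j, IsSmoothProjective 1 (C j))
          (T : ∀ j, complexBetti (C j) 1 →ₗ[ℂ] complexBetti Y 3),
          (∀ j, IsAlgebraicCorrespondence 3 1 Y (C j) (T j)) ∧
            Submodule.span ℂ (↑s : Set (complexBetti Y 3)) ≤ ⨆ j, LinearMap.range (T j)) :
    ∃ (Y : SchemeOver ℂ) (_ : IsSmoothProjective 3 Y) (M : HodgeModel 3 Y)
      (s : Finset (complexBetti Y 3)),
      (∀ c ∈ s, IsRationalClass c) ∧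
      Module.finrank ℂ (M.hodgePQ 3 3 0) = 1 ∧
      Module.finrank ℂ (Submodule.span ℂ (↑s : Set (complexBetti Y 3))) = 2 ∧
      ¬ Submodule.span ℂ (↑s : Set (complexBetti Y 3)) ≤ supportedClasses Y 3 1 ∧
      ¬ ∃ A : AbelianVariety ℂ, A.dim = 3 ∧ Nonempty (Y ≅ A.X) := by
  obtain ⟨Y, hY, M, s, hs, hsub, hlev, h30, hs2, hoff⟩ := h
  exact ⟨Y, hY, M, s, hs, h30, hs2,
    fun hle ↦ hoff ((le_supportedClasses_iff_exists_curveCorrespondences hY _).1 hle),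
    not_iso_abelianThreefold_of_heartWitness hM hY M s hs hsub hlev hs2 hoff⟩

/-! ### The calibration threefold `E_τ³` of the route: no rank-two plane is a witness -/

/-- **Rank-two GHC(3,1) at Grothendieck's calibration threefold `E_τ³` (granted Markman 2025).**
For `Im τ ≠ 0`, the cube `cubeScheme τ hτ = E_τ ⊗ (E_τ ⊗ E_τ)` of the Weierstrass cubic of the
lattice `ℤ + τℤ` IS, definitionally, the underlying variety of the abelian threefold
`E × (E × E)` for the bundled elliptic curve `E = E_τ` with its chord–tangent law
(`WeierstrassCurve.abelianVarietyOfAddHom`, `AbelianVariety.prod_X`, `dim = 1 + (1 + 1)`); so every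
rationally spanned level-one sub-Hodge structure of `H³(E_τ³(ℂ); ℂ)` of dimension `2` lies in
`N¹H³(E_τ³)`. With lead c2's habitat theorem (`exists_levelOnePlane_calabiYauType_ellipticCurveCubed`:
at `E_i³` the habitat clauses of the heart hold for the plane `⟨α₀β₀α₁, α₀β₀β₁⟩`) this is the route's
calibration kill criterion (c) in rank two: at the calibration threefold the heart's obstruction
FAILS for every rank-two plane. [claim: Markman2025SurveySecant, status: under-review]
[cite: GrothendieckTopology1969, p. 300] [cite: SilvermanAEC2009, III.3.6] -/
theorem span_le_supportedClasses_of_finrank_eq_two_ellipticCurveCubed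
    (hM : Markman2025_hodgeClasses_algebraic_abelian_dim_le_five) (τ : ℂ) (hτ : τ.im ≠ 0)
    (M : HodgeModel 3 (cubeScheme τ hτ)) (s : Finset (complexBetti (cubeScheme τ hτ) 3))
    (hs : ∀ c ∈ s, IsRationalClass c)
    (hs2 : Module.finrank ℂ (Submodule.span ℂ (↑s : Set (complexBetti (cubeScheme τ hτ) 3))) = 2)
    (hsub : (Submodule.span ℂ (↑s : Set (complexBetti (cubeScheme τ hτ) 3))).map (M.pullback 3).hom =
      ⨆ (p : ℕ) (q : ℕ) (_ : p + q = 3),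
        (Submodule.span ℂ (↑s : Set (complexBetti (cubeScheme τ hτ) 3))).map (M.pullback 3).hom ⊓
          M.hodgePQ 3 p q)
    (hlev : (Submodule.span ℂ (↑s : Set (complexBetti (cubeScheme τ hτ) 3))).map (M.pullback 3).hom ≤
      ⨆ (p : ℕ) (q : ℕ) (_ : p + q = 3) (_ : 1 ≤ p) (_ : 1 ≤ q), M.hodgePQ 3 p q) :
    Submodule.span ℂ (↑s : Set (complexBetti (cubeScheme τ hτ) 3)) ≤
      supportedClasses (cubeScheme τ hτ) 3 1 := by
  -- the bundled elliptic curve `E_τ` and the abelian threefold `E × (E × E)`, whose `.X` is the cube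
  let W : WeierstrassCurve ℂ := (cubePeriodPair τ hτ).curve
  let E : AbelianVariety ℂ := W.abelianVarietyOfAddHom W.addHom W.negHom
    W.lift_pointEquiv_comp_addHom W.pointEquiv_comp_negHom_geom
  have hE : E.dim = 1 := dim_abelianVarietyOfAddHom W _ _ _ _
  have h3 : (E.prod (E.prod E)).dim = 3 := by
    rw [AbelianVariety.dim_prod, AbelianVariety.dim_prod, hE]
  exact span_le_supportedClasses_of_finrank_eq_two_abelianThreefold hM (E.prod (E.prod E)) h3 M s hs
    hs2 hsub hlev

/-! ### The registered sub-goals of the line (binders after the colon) -/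

/-- **Registered sub-goal (lead c3, crux stmt-HodgeConjecture-3540): rank-two GHC(3,1) for complex
abelian threefolds, granted Markman 2025** (`span_le_supportedClasses_of_finrank_eq_two_abelianThreefold`
with all binders after the colon). [claim: Markman2025SurveySecant, status: under-review]
[cite: GrothendieckTopology1969, p. 301] -/
theorem span_le_supportedClasses_rankTwo_abelianThreefold_of_markman : Markman2025_hodgeClasses_algebraic_abelian_dim_le_five → ∀ (A : AbelianVariety ℂ), A.dim = 3 → ∀ (M : HodgeModel 3 A.X) (s : Finset (complexBetti A.X 3)), (∀ c ∈ s, IsRationalClass c) → Module.finrank ℂ (Submodule.span ℂ (↑s : Set (complexBetti A.X 3))) = 2 → (Submodule.span ℂ (↑s : Set (complexBetti A.X 3))).map (M.pullback 3).hom = (⨆ (p : ℕ) (q : ℕ) (_ : p + q = 3), (Submodule.span ℂ (↑s : Set (complexBetti A.X 3))).map (M.pullback 3).hom ⊓ M.hodgePQ 3 p q) → (Submodule.span ℂ (↑s : Set (complexBetti A.X 3))).map (M.pullback 3).hom ≤ (⨆ (p : ℕ) (q : ℕ) (_ : p + q = 3) (_ : 1 ≤ p) (_ : 1 ≤ q),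 M.hodgePQ 3 p q) → Submodule.span ℂ (↑s : Set (complexBetti A.X 3)) ≤ supportedClasses A.X 3 1 :=
  fun hM A hA M s hs hs2 hsub hlev ↦
    span_le_supportedClasses_of_finrank_eq_two_abelianThreefold hM A hA M s hs hs2 hsub hlev

/-- **Registered sub-goal (lead c3, crux stmt-HodgeConjecture-3540): a heart witness is not an abelian
threefold, granted Markman 2025** (`not_abelianThreefold_of_heartWitness` with all binders after the
colon). [claim: Markman2025SurveySecant, status: under-review] [cite: GrothendieckTopology1969, p. 301] -/
theorem not_abelianThreefold_of_heartWitness_of_markman : Markman2025_hodgeClasses_algebraic_abelian_dim_le_five → ∀ ⦃Y : SchemeOver ℂ⦄ (M : HodgeModel 3 Y) (s : Finset (complexBetti Y 3)), (∀ c ∈ s, IsRationalClass c) → (Submodule.span ℂ (↑s : Set (complexBetti Y 3))).map (M.pullback 3).hom = (⨆ (p : ℕ) (q : ℕ) (_ : p + q = 3), (Submodule.span ℂ (↑s : Set (complexBetti Y 3))).map (M.pullback 3).hom ⊓ M.hodgePQ 3 p q) → (Submodule.span ℂ (↑s : Set (complexBetti Y 3))).map (M.pullback 3).hom ≤ (⨆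 (p : ℕ) (q : ℕ) (_ : p + q = 3) (_ : 1 ≤ p) (_ : 1 ≤ q), M.hodgePQ 3 p q) → Module.finrank ℂ (Submodule.span ℂ (↑s : Set (complexBetti Y 3))) = 2 → (¬ ∃ (ι : Type) (_ : Finite ι) (C : ι → SchemeOver ℂ) (_ : ∀ j, IsSmoothProjective 1 (C j)) (T : ∀ j, complexBetti (C j) 1 →ₗ[ℂ] complexBetti Y 3), (∀ j, IsAlgebraicCorrespondence 3 1 Y (C j) (T j)) ∧ Submodule.span ℂ (↑s : Set (complexBetti Y 3)) ≤ ⨆ j, LinearMap.range (T j)) → ¬ ∃ A : AbelianVariety ℂ, A.dim = 3 ∧ A.X = Y :=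
  fun hM _ M s hs hsub hlev hs2 hoff ↦ not_abelianThreefold_of_heartWitness hM M s hs hsub hlev hs2 hoff

end Summit.HodgeConjecture.HodgeConjecture.Theorems

end
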